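import Summits.QuantumFields.YangMills.Theses.UniversalDetector
import Summits.QuantumFields.YangMills.Theorems.LangevinControlUVOSLegsFromFemtoAndGapStubAssemblyPlaneExpansion

/-!
# Route `UniversalDetector`, support item `TightOfPlaneTight` (stmt-QuantumFields-23252) — proof

Ideator seat ym-idea-8 g7 (LINE 4 of rung R2a = `BalabanLadder.NT`, plane-resolved repair rev 1).  The item says
`TIGHT6 ⇒ TIGHT`: if each of the 36 unit-normalised plane–plane covariance kernels
`ker6_{β,L}(p,q,z) = a(β)⁻⁸ Cov_T(plane p 0, plane q z)` is bounded and equicontinuous at fixed physical separation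
(uniformly in `β ≥ β₅`, `a(β) L ≥ Λ₅`), then so is the full kernel `ker_{β,L}(z) = a(β)⁻⁸ Cov_T(dens 0, dens z)`.
Proof: the action density is the sum of the six plane fields (`dens_eq_sum_filter_plane`), the torus Wilson
measure is a probability measure and the plane fields are bounded and measurable through the periodic lift, so the
covariance is the double orientation sum of the plane covariances (`cov_dens_eq_sum_cov_plane`); hence
`ker = Σ_{(p,q) valid} ker6 p q`, and one takes `C = Σ C_{pq}`, `β₅ = Σ |β₅^{pq}|`, `Λ₅ = Σ |Λ₅^{pq}|`, `ω = Σ ω_{pq}`.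
No summit, rung or crux is proved here: `NT` stays open behind `PlaneTightScheme`, `PlaneLimitExtraction` and the
residual `SkewAtScheme`.
-/

set_option autoImplicit false

noncomputable section

open MeasureTheory Filter Topology
open Literature.MathematicalPhysics.QuantumFieldTheory Literature.MathematicalPhysics.QuantumLattice
  Literature.Probability.LatticeModels
open Summit.QuantumFields.YangMills.Cruxes.OSLegsFromFemtoAndGap.DlrCollarTransfer
open Summit.QuantumFields.YangMills.Theorems.OSLegsFromFemtoAndGap
  (dens_eq_sum_filter_plane measurable_plane_lift torusE_dens_eq_sum)

namespace Summit.QuantumFields.YangMills.Cruxes.UniversalDetectorPlaneTight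

variable {G : Type} [Group G] [TopologicalSpace G] [IsTopologicalGroup G] [CompactSpace G]
  [MeasurableSpace G] [BorelSpace G] (r : LatticeRep G)

/-- Products of two plane fields read through the periodic lift are integrable for Wilson's measure. -/
theorem integrable_plane_mul_lift (β : ℝ) (L : ℕ) (p q : Fin 4 × Fin 4) (x y : Fin 4 → ℤ) :
    Integrable (fun U : GaugeConfig 4 (2 * L + 1) G =>
        plane G r p x (torusLift (2 * L + 1) U) * plane G r q y (torusLift (2 * L + 1) U))
      (wilsonMeasure (d := 4) (L := 2 * L + 1) r.ρ β) := by
  haveI := isProbabilityMeasure_wilsonMeasure (d := 4) (L := 2 * L + 1) r.ρ r.continuous β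
  obtain ⟨C, hC⟩ := exists_abs_plane_le (G := G) r
  refine Integrable.of_bound
    ((measurable_plane_lift r L p x).mul (measurable_plane_lift r L q y)).aestronglyMeasurable (C * C)
    (Eventually.of_forall fun U => ?_)
  rw [Real.norm_eq_abs, abs_mul]
  exact mul_le_mul (hC p x (torusLift (2 * L + 1) U)) (hC q y (torusLift (2 * L + 1) U)) (abs_nonneg _)
    ((abs_nonneg _).trans (hC p x (torusLift (2 * L + 1) U)))

/-- **The torus mean of a product of densities is the double orientation sum of plane-pair means.** -/
theorem torusE_dens_mul_dens_eq_sum (β : ℝ) (L : ℕ) (x y : Fin 4 → ℤ) :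
    torusE G r β L (fun U => dens G r x U * dens G r y U) =
      ∑ p ∈ Finset.univ.filter (fun q : Fin 4 × Fin 4 => q.1 < q.2),
        ∑ q ∈ Finset.univ.filter (fun q : Fin 4 × Fin 4 => q.1 < q.2),
          torusE G r β L (fun U => plane G r p x U * plane G r q y U) := by
  simp only [torusE]
  have h1 : ∀ U : LGConfig 4 G, dens G r x U * dens G r y U =
      ∑ p ∈ Finset.univ.filter (fun q : Fin 4 × Fin 4 => q.1 < q.2),
        ∑ q ∈ Finset.univ.filter (fun q : Fin 4 × Fin 4 => q.1 < q.2), plane G r p x U * plane G r q y U := by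
    intro U
    rw [dens_eq_sum_filter_plane, dens_eq_sum_filter_plane, Finset.sum_mul_sum]
  simp_rw [h1]
  rw [integral_finsetSum _ (fun p _ => ?_)]
  · refine Finset.sum_congr rfl fun p _ => ?_
    rw [integral_finsetSum _ (fun q _ => integrable_plane_mul_lift r β L p q x y)]
  · exact integrable_finsetSum _ (fun q _ => integrable_plane_mul_lift r β L p q x y)

/-- **The density–density torus covariance is the double orientation sum of the plane–plane covariances.** -/
theorem cov_dens_eq_sum_cov_plane (β : ℝ) (L : ℕ) (x y : Fin 4 → ℤ) :
    torusE G r β L (fun U => dens G r x U * dens G r y U) - torusE G r β L (dens G r x) * torusE G r β L (dens G r y) =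
      ∑ p ∈ Finset.univ.filter (fun q : Fin 4 × Fin 4 => q.1 < q.2),
        ∑ q ∈ Finset.univ.filter (fun q : Fin 4 × Fin 4 => q.1 < q.2),
          (torusE G r β L (fun U => plane G r p x U * plane G r q y U) -
            torusE G r β L (plane G r p x) * torusE G r β L (plane G r q y)) := by
  rw [torusE_dens_mul_dens_eq_sum, torusE_dens_eq_sum r β L x, torusE_dens_eq_sum r β L y, Finset.sum_mul_sum]
  simp only [Finset.sum_sub_distrib]

/-- **TIGHT6 ⇒ TIGHT** (route `UniversalDetector`, item `TightOfPlaneTight`): the full unit-normalised kernel is the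
sum of the 36 plane kernels, so bounds and moduli add up over the orientation pairs. -/
theorem tightOfPlaneTight : Summit.QuantumFields.YangMills.Theses.UniversalDetector.TightOfPlaneTight := by
  intro G _ _ _ _ _ _ r a ker ker6 h6 η hη
  -- the valid orientation pairs as a finite type
  let S := {s : (Fin 4 × Fin 4) × (Fin 4 × Fin 4) // s.1.1 < s.1.2 ∧ s.2.1 < s.2.2}
  have hsplit : ∀ (β : ℝ) (L : ℕ) (z : Fin 4 → ℤ), ker β L z = ∑ s : S, ker6 β L s.1.1 s.1.2 z := by
    intro β L z
    have hmem : ∀ s : (Fin 4 × Fin 4) × (Fin 4 × Fin 4),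
        s ∈ (Finset.univ.filter (fun q : Fin 4 × Fin 4 => q.1 < q.2)) ×ˢ
            (Finset.univ.filter (fun q : Fin 4 × Fin 4 => q.1 < q.2)) ↔ s.1.1 < s.1.2 ∧ s.2.1 < s.2.2 := by
      intro s; simp [Finset.mem_product]
    rw [← Finset.sum_subtype _ hmem (fun s => ker6 β L s.1 s.2 z), Finset.sum_product]
    simp only [ker, ker6]
    rw [cov_dens_eq_sum_cov_plane, Finset.mul_sum]
    simp_rw [Finset.mul_sum]
  choose C β₅ Λ₅ ω hω hmain using fun s : S => h6 s.1.1 s.1.2 s.2.1 s.2.2 η hη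
  refine ⟨∑ s, C s, ∑ s, |β₅ s|, ∑ s, |Λ₅ s|, fun t => ∑ s, ω s t, ?_, ?_⟩
  · have h := tendsto_finsetSum (Finset.univ : Finset S) (fun s _ => hω s)
    simpa using h
  · intro β hβ L hL z hz hzη
    have hβs : ∀ s : S, β₅ s ≤ β := fun s =>
      (le_abs_self _).trans ((Finset.single_le_sum (fun s' _ => abs_nonneg (β₅ s')) (Finset.mem_univ s)).trans hβ)
    have hLs : ∀ s : S, Λ₅ s ≤ a β * L := fun s =>
      (le_abs_self _).trans ((Finset.single_le_sum (fun s' _ => abs_nonneg (Λ₅ s')) (Finset.mem_univ s)).trans hL)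
    have hm : ∀ s : S, |ker6 β L s.1.1 s.1.2 z| ≤ C s ∧ ∀ z' ∈ box 4 L, η ≤ ‖a β • siteToE z'‖ →
        |ker6 β L s.1.1 s.1.2 z - ker6 β L s.1.1 s.1.2 z'| ≤ ω s ‖a β • siteToE z - a β • siteToE z'‖ :=
      fun s => hmain s β (hβs s) L (hLs s) z hz hzη
    refine ⟨?_, fun z' hz' hz'η => ?_⟩
    · rw [hsplit]
      exact (Finset.abs_sum_le_sum_abs _ _).trans (Finset.sum_le_sum fun s _ => (hm s).1)
    · rw [hsplit, hsplit, ← Finset.sum_sub_distrib]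
      exact (Finset.abs_sum_le_sum_abs _ _).trans (Finset.sum_le_sum fun s _ => (hm s).2 z' hz' hz'η)

end Summit.QuantumFields.YangMills.Cruxes.UniversalDetectorPlaneTight

end
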